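import Mathlib
import Literature.RingTheory.KrullDimension.AffineDimension

/-!
# Crux `PicoverLocalModel` (stmt-ResolutionOfSingularities-0557), line `SketchIdeator3`
# (giraud-cossart-normal-form) — the WOUND exit of the endgame atlas

Registered helper of the endgame stub `stub_endgameAtlas`: at a wound point of the regular
modification the (twisted) radicand is an element `u` of the regular local ring `O = 𝒪_{W,w}`
whose residue class `ū ∈ κ = O/𝔪` is not a `p`-th power, i.e. `∀ c, u - c ^ p ∉ 𝔪`. Then the
purely inseparable cover `O' := O[T]/(T^p - u)` is again a REGULAR LOCAL ring:

* `O'` is finite free over `O` (monic defining polynomial), so `O → O'` is injective and integral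
  and `dim O' = dim O` (`Literature.RingTheory.KrullDimension.ringKrullDim_eq_of_isIntegral`);
* `O'/𝔪O' ≅ κ[T]/(T^p - ū)` (`AdjoinRoot.quotEquivQuotMap`) is a field, because `T^p - ū` is
  irreducible over `κ` (`Polynomial.X_pow_sub_C_irreducible_of_prime`, any characteristic), so
  `𝔪O'` is a maximal ideal of `O'`;
* every maximal ideal of `O'` contracts to `𝔪` (integrality), hence contains — and so equals —
  `𝔪O'`: `O'` is local with maximal ideal `𝔪O'`;
* `𝔪O'` is generated by the images of `dim O` generators of `𝔪`, so
  `μ(𝔪_{O'}) ≤ dim O = dim O'` and `O'` is regular.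

Contents: `isMaximal_map_maximalIdeal_adjoinRoot` (the fibre `O'/𝔪O'` is a field),
`isLocalRing_adjoinRoot_of_wound` (locality with maximal ideal `𝔪O'`),
`isRegularLocalRing_adjoinRoot_of_wound` (the registered helper). No statement item is restated.
-/

-- The namespace mirrors the crux/line layout (`…Theorems.PicoverLocalModel.WoundExit`) on purpose.
set_option linter.dupNamespace false

noncomputable section

namespace Summit.ResolutionOfSingularities.ResolutionOfSingularities.Theorems.PicoverLocalModel.WoundExit

open Polynomial IsLocalRing

/-- **The closed fibre of a wound cover is a field.** For a local ring `(O, 𝔪)`, a prime `p` and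
`u ∈ O` whose residue is not a `p`-th power (`∀ c, u - c ^ p ∉ 𝔪`), the extended ideal
`𝔪 · O[T]/(T^p - u)` is maximal: the quotient is `κ[T]/(T^p - ū)` with `T^p - ū` irreducible
over the residue field `κ`. [folklore] -/
theorem isMaximal_map_maximalIdeal_adjoinRoot {O : Type*} [CommRing O] [IsLocalRing O] {p : ℕ}
    (hp : p.Prime) {u : O} (hu : ∀ c : O, u - c ^ p ∉ maximalIdeal O) :
    ((maximalIdeal O).map (AdjoinRoot.of ((X : O[X]) ^ p - C u))).IsMaximal := by
  letI : Field (O ⧸ maximalIdeal O) := Ideal.Quotient.field _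
  have hmap : ((X : O[X]) ^ p - C u).map (Ideal.Quotient.mk (maximalIdeal O)) =
      X ^ p - C (Ideal.Quotient.mk (maximalIdeal O) u) := by
    rw [Polynomial.map_sub, Polynomial.map_pow, map_X, map_C]
  have hirr : Irreducible (((X : O[X]) ^ p - C u).map (Ideal.Quotient.mk (maximalIdeal O))) := by
    rw [hmap]
    refine X_pow_sub_C_irreducible_of_prime hp fun b hb => ?_
    obtain ⟨c, rfl⟩ := Ideal.Quotient.mk_surjective b
    rw [← map_pow, Ideal.Quotient.eq] at hb
    have hb' : u - c ^ p ∈ maximalIdeal O := by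
      rw [← neg_sub]
      exact (maximalIdeal O).neg_mem hb
    exact hu c hb'
  haveI : Fact (Irreducible (((X : O[X]) ^ p - C u).map (Ideal.Quotient.mk (maximalIdeal O)))) :=
    ⟨hirr⟩
  -- the fibre `κ[T]/(T^p - ū)` is a field (`AdjoinRoot.span_maximal_of_irreducible`)
  have hF : IsField ((O ⧸ maximalIdeal O)[X] ⧸
      Ideal.span {((X : O[X]) ^ p - C u).map (Ideal.Quotient.mk (maximalIdeal O))}) :=
    (Ideal.Quotient.maximal_ideal_iff_isField_quotient _).mp
      (AdjoinRoot.span_maximal_of_irreducible (K := O ⧸ maximalIdeal O))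
  exact Ideal.Quotient.maximal_of_isField _
    (MulEquiv.isField hF (AdjoinRoot.quotEquivQuotMap ((X : O[X]) ^ p - C u)
      (maximalIdeal O)).toMulEquiv)

/-- **A wound cover of a local ring is local.** For a local ring `(O, 𝔪)`, a prime `p` and
`u ∈ O` with `∀ c, u - c ^ p ∉ 𝔪`, the finite `O`-algebra `O' = O[T]/(T^p - u)` is a local ring
and its maximal ideal is the extended ideal `𝔪O'` (every maximal ideal of the integral extension
`O'` lies over `𝔪`, hence contains the maximal ideal `𝔪O'`). [folklore] -/
theorem isLocalRing_adjoinRoot_of_wound {O : Type*} [CommRing O] [IsLocalRing O] {p : ℕ}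
    (hp : p.Prime) {u : O} (hu : ∀ c : O, u - c ^ p ∉ maximalIdeal O) :
    ∃ _ : IsLocalRing (AdjoinRoot ((X : O[X]) ^ p - C u)),
      maximalIdeal (AdjoinRoot ((X : O[X]) ^ p - C u)) =
        (maximalIdeal O).map (AdjoinRoot.of ((X : O[X]) ^ p - C u)) := by
  have hf : ((X : O[X]) ^ p - C u).Monic := monic_X_pow_sub_C u hp.ne_zero
  haveI : Module.Finite O (AdjoinRoot ((X : O[X]) ^ p - C u)) := hf.finite_adjoinRoot
  haveI : Algebra.IsIntegral O (AdjoinRoot ((X : O[X]) ^ p - C u)) := inferInstance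
  have hM := isMaximal_map_maximalIdeal_adjoinRoot hp hu
  haveI : IsLocalRing (AdjoinRoot ((X : O[X]) ^ p - C u)) := by
    refine IsLocalRing.of_unique_max_ideal ⟨_, hM, fun N hN => ?_⟩
    have h1 : N.comap (algebraMap O (AdjoinRoot ((X : O[X]) ^ p - C u))) = maximalIdeal O :=
      IsLocalRing.eq_maximalIdeal (Ideal.isMaximal_comap_of_isIntegral_of_isMaximal N)
    have h2 : (maximalIdeal O).map (AdjoinRoot.of ((X : O[X]) ^ p - C u)) ≤ N := by
      rw [← h1, AdjoinRoot.algebraMap_eq]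
      exact Ideal.map_comap_le
    exact (hM.eq_of_le hN.ne_top h2).symm
  exact ⟨inferInstance, (IsLocalRing.eq_maximalIdeal hM).symm⟩

/-- **Wound exit of the endgame atlas.** Let `(O, 𝔪)` be a regular local ring, `p` a prime and
`u ∈ O` an element whose residue class is not a `p`-th power in the residue field
(`∀ c, u - c ^ p ∉ 𝔪`). Then the purely inseparable `p`-cyclic cover `O[T]/(T^p - u)` is a
regular local ring: it is local with maximal ideal `𝔪O'` (closed fibre `κ[T]/(T^p - ū)` a field),
`𝔪O'` needs at most `dim O` generators, and `dim O' = dim O` (finite injective extension).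
[folklore] -/
theorem isRegularLocalRing_adjoinRoot_of_wound : ∀ {O : Type*} [CommRing O] [IsRegularLocalRing O] (p : ℕ), p.Prime → ∀ (u : O), (∀ c : O, u - c ^ p ∉ IsLocalRing.maximalIdeal O) → IsRegularLocalRing (AdjoinRoot ((Polynomial.X : Polynomial O) ^ p - Polynomial.C u)) := by
  intro O _ _ p hp u hu
  have hf : ((X : O[X]) ^ p - C u).Monic := monic_X_pow_sub_C u hp.ne_zero
  haveI : Module.Finite O (AdjoinRoot ((X : O[X]) ^ p - C u)) := hf.finite_adjoinRoot
  haveI : Module.Free O (AdjoinRoot ((X : O[X]) ^ p - C u)) := hf.free_adjoinRoot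
  haveI : Algebra.IsIntegral O (AdjoinRoot ((X : O[X]) ^ p - C u)) := inferInstance
  haveI : Nontrivial (AdjoinRoot ((X : O[X]) ^ p - C u)) := by
    refine Ideal.Quotient.nontrivial_iff.mpr ?_
    rw [Ne, Ideal.span_singleton_eq_top, hf.isUnit_iff]
    intro h1
    have h := congrArg natDegree h1
    rw [natDegree_X_pow_sub_C, natDegree_one] at h
    exact hp.ne_zero h
  have hinj : Function.Injective (algebraMap O (AdjoinRoot ((X : O[X]) ^ p - C u))) :=
    FaithfulSMul.algebraMap_injective O _
  obtain ⟨_, hmax⟩ := isLocalRing_adjoinRoot_of_wound hp hu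
  haveI : IsNoetherianRing (AdjoinRoot ((X : O[X]) ^ p - C u)) := inferInstance
  refine IsRegularLocalRing.of_spanFinrank_maximalIdeal_le _ ?_
  have hdim : ringKrullDim (AdjoinRoot ((X : O[X]) ^ p - C u)) = ringKrullDim O :=
    (Literature.RingTheory.KrullDimension.ringKrullDim_eq_of_isIntegral hinj).symm
  rw [hmax, hdim, ← IsRegularLocalRing.spanFinrank_maximalIdeal]
  exact_mod_cast Ideal.spanFinrank_map_le_of_fg (AdjoinRoot.of ((X : O[X]) ^ p - C u))
    (IsNoetherian.noetherian _)

end Summit.ResolutionOfSingularities.ResolutionOfSingularities.Theorems.PicoverLocalModel.WoundExit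

end
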